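import Summits.BirchSwinnertonDyer.Rank1Residual.X11b.ChaRoute
import Summits.BirchSwinnertonDyer.Rank1Residual.X11b.ChaPairsMinimality
import Summits.BirchSwinnertonDyer.Rank1Residual.X11b.ChaPairsCards
import Summits.BirchSwinnertonDyer.BirchSwinnertonDyer.Theorems.Rank1ResidualX11RankOneReduction
import HarnessLib

/-!
# BSD rank-≤1 residual cell, class X11b: `BSD(E,5)` from PUBLISHED theorems + a two-engine Heegner-index
# certificate for the Cha-certified RESISTANT pairs of X11 ∧ r = 1 ∧ ¬sst ∧ p ≥ 5 (part 1 of 3)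

HONEST FRAMING (cell `b2b-bsdres-*`, verbatim): prove what is provable now; shrink each hard class
to its core with data; no claim beyond stated classes; COMBINATION classes deleted from PUBLISHED
theorems only, CONSTRUCTION-shaped remainder typed; this is not "finishing BSD". Class X11b stays
CONSTRUCTION-SHAPED; everything here is PER PAIR; no lane verdict is changed; no named fact.

Unit `b2b-bsdres-x11c`, gen 3. The RESISTANT list of the unit's `p`-adic certificate route
(HOME/b2b-bsdres-x11c/REPORT.md §4: 64 pairs at `p = 5` with `ρ̄_{E,5}` irreducible NOT surjective
— Sutherland `5S4` ×52, `5Ns` ×12 — and no (ram) witness, `N < 5·10⁵`, plus `403280bd1@5` with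
`#Ш_an = 25`) is attacked with the PUBLISHED per-curve theorem that needs neither surjectivity nor
(ram): Cha 2005 (tree fact `Cha2005.thm52_padicValNat_shaOrder_le`, as printed by Miller 2011
Thm. 5.2 / GJPST 2009 Thm. 3.5, flag `Cha05-primary-unread`; its reduction hypothesis `p² ∤ N`
allows `p ∥ N`). The route file `X11b/ChaRoute.lean` shows that on the cell's class X11b every
Galois / reduction hypothesis of Cha's theorem is automatic. Here, for each of the 24 pairs with
`5 ∤ ∏ c_q` (8 per part, by increasing conductor):

* the theorem `bsdp_c<label>`: for `W =` Cremona's model (literal a-invariants; NO instance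
  hypothesis — `Δ ≠ 0` and global minimality are decided in the kernel, the latter by
  `isGloballyMinimal_of_krausCriterion_bounded₂`), the published binders `hCha`, `hGZK`, the Heegner
  datum (`K` imaginary quadratic with the Heegner hypothesis for the level `N` and `5 ∤ d_K`,
  `5² ∤ N`, a Heegner point `P` of infinite order, `5 ∤ [E(K) : ℤ P]`), `r_an(E) ≤ 1` and
  `#Ш_an = q` with `ord₅ q = 0` give Miller's `BSDp W 5`; multiplicative reduction at `5`
  (`5 ∣ Δ`, `5 ∤ c₄`) and irreducibility of `E[5]` (Frobenius witness `ℓ`, kernel point count of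
  `ChaPairsCards.lean`, root-freeness mod `5`) are KERNEL facts (`decide`), through the generic
  `bsdp_of_ainvs_of_chaCertificate` (part 1, §1).

The numbers left as binders are exactly what the lane certifies by two engines: `r_an = 1`,
`#Ш_an = 1`, and the Heegner-index certificate — engine 1 (cypari2 = X9 gen 7 `jobD1b.py`
verbatim; jobs j077792, j077793): Miller 2011 Thm. 4.1 / Cor. 4.8 normalisation
`ĥ(y_K) = L'(E,1)·L(E^D,1)·√|D| / (4·Area)`, `ρ = ĥ(y_K)/ĥ(x)`, `m = √(4ρ) ∈ ℤ`, `ord₅ m = 0`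
for the field `K = ℚ(√D)` named in each docstring; engine 2 (stdlib python = X9 gen 7 `eng2`
verbatim; jobs j077948–j077959). For the 40 resistant pairs with `5 ∣ c_q` for some `q` every
Heegner field gives `5 ∣ m` (97 `BOUND` rows, jobs j077797/j077800), as Gross–Zagier + BSD over `K`
predict (`[E(K) : ℤ y_K] = c·∏c_q·#Ш(E/K)^{1/2}` up to `2`-powers): those pairs stay RESISTANT with
that named failing hypothesis (REPORT §11). Labels certified here (part 1): `3240a1`, `5780b1`, `6480a1`, `21660j1`, `23120v1`, `25920a1`, `51840g1`, `52020u1`.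

References: B. Cha, J. Number Theory 111 (2005) [Cha2005]; R. L. Miller, LMS JCM 14 (2011) Thm. 5.2,
Thm. 4.1, Cor. 4.8 [Miller2011LMS]; GJPST, Math. Comp. 78 (2009) Thm. 3.5 [GrigorovJorzaPatrikisSteinTarnita2009];
B. Mazur, Invent. Math. 44 (1978) Prop. 6.3 (1) [Mazur1978]; J. H. Silverman, *AEC* (2009) VII.1,
VII.5 [SilvermanAEC2009]; A. Kraus, Acta Arith. 54 (1989) [Kraus1989]; Cremona's tables [Cremona2006].
-/

set_option linter.dupNamespace false
set_option autoImplicit false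

noncomputable section

open scoped Classical

open WeierstrassCurve Literature.NumberTheory.EllipticCurves
  Literature.NumberTheory.EllipticCurves.Rank1Residual
  Literature.NumberTheory.EllipticCurves.Rank1Residual.X11RankOneCertificates
  Literature.NumberTheory.EllipticCurves.Cha2005
  Summit.BirchSwinnertonDyer.BirchSwinnertonDyer.Rank1Residual.IntModel
  Summit.BirchSwinnertonDyer.BirchSwinnertonDyer.Rank1Residual.X11RankOne

namespace Summit.BirchSwinnertonDyer.Rank1Residual.X11b

/-! ### §1. The certificate shape for a literal integer model -/

/-- **`BSD(E,p)` from Cha's Heegner-index certificate for a globally minimal `W/ℚ` with integral model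
`[a₁,…,a₆]`, all Galois/reduction hypotheses from DECIDABLE integer data**: `p ∣ Δ`, `p ∤ c₄`
(multiplicative reduction at `p`, hence `E` non-CM), a good prime `ℓ ≠ p` (`ℓ ∤ Δ`) with kernel point
count `#Ẽ(𝔽_ℓ) = n` and `X² − (ℓ + 1 − n)X + ℓ` root-free mod `p` (`E[p]` irreducible, Mazur 1978
Prop. 6.3 (1)); PUBLISHED binders Cha 2005 (`hCha`) and GZK (`hGZK`); certificate binders `K`
(Heegner for the level `N`, `p ∤ d_K`), `p² ∤ N`, Heegner point `P` of infinite order with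
`p ∤ [E(K) : ℤ P]`, `r_an ≤ 1`, `#Ш_an = q` with `ord_p q = 0`. Composition of
`X11b.bsdp_of_mult_of_chaCertificate` with the `IntModel` toolkit. Per pair; not a class theorem.
[cite: Miller2011LMS, Thm. 5.2 and Def. 1.1] [cite: Mazur1978, §6 Prop. 6.3 (1) (p. 153)]
[cite: SilvermanAEC2009, VII.5 Prop. 5.1(b)] -/
theorem bsdp_of_ainvs_of_chaCertificate (hCha : thm52_padicValNat_shaOrder_le)
    (hGZK : rank_eq_analyticRank_of_analyticRank_le_one) (a1 a2 a3 a4 a6 : ℤ)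
    {W : WeierstrassCurve ℚ} [W.IsElliptic] [W.IsGloballyMinimal]
    (hW : integralModelInt W = ⟨a1, a2, a3, a4, a6⟩) (p ℓ n : ℕ) [Fact p.Prime] [Fact ℓ.Prime]
    (hp2 : p ≠ 2) (hpΔ : (p : ℤ) ∣ discOf [a1, a2, a3, a4, a6])
    (hpc4 : ¬ (p : ℤ) ∣ c4Of [a1, a2, a3, a4, a6]) (hℓp : ℓ ≠ p)
    (hℓΔ : ¬ (ℓ : ℤ) ∣ discOf [a1, a2, a3, a4, a6])
    (hcard : Nat.card (((⟨a1, a2, a3, a4, a6⟩ : WeierstrassCurve ℤ).map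
      (Int.castRingHom (ZMod ℓ))).toAffine.Point) = n)
    (hnoroot : ∀ t : ℕ, t < p → ¬ (p : ℤ) ∣ (t : ℤ) ^ 2 - ((ℓ : ℤ) + 1 - n) * t + ℓ)
    {N : ℕ} [NeZero N] {K : Type} [Field K] [NumberField K] (hK : IsImaginaryQuadratic K)
    (hH : SatisfiesHeegnerHypothesis N K) {P : (W.baseChange K).toAffine.Point}
    (hP : IsHeegnerPoint N W K P) (hnt : ¬ IsOfFinAddOrder P)
    (hpD : ¬ (p : ℤ) ∣ NumberField.discr K) (hpN : ¬ p ^ 2 ∣ N)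
    (hI : ¬ p ∣ (AddSubgroup.zmultiples P).index)
    (hr : W.analyticRank ≤ 1) {q : ℚ} (hq : shaAn W = (q : ℂ)) (hv : padicValRat p q = 0) :
    BSDp W p := by
  haveI : NeZero p := ⟨(Fact.out : p.Prime).ne_zero⟩
  have hΔ : (⟨a1, a2, a3, a4, a6⟩ : WeierstrassCurve ℤ).Δ = discOf [a1, a2, a3, a4, a6] :=
    intCurve_Δ a1 a2 a3 a4 a6
  have hc4 : (⟨a1, a2, a3, a4, a6⟩ : WeierstrassCurve ℤ).c₄ = c4Of [a1, a2, a3, a4, a6] :=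
    intCurve_c₄ a1 a2 a3 a4 a6
  have hmult : Mult W p :=
    hasMultiplicativeReductionAtPrime_of_intModel hW p (by rw [hΔ]; exact hpΔ) (by rw [hc4]; exact hpc4)
  have hirr : Irr W p := by
    refine hasIrreducibleModPGaloisRep_of_intModel_of_noroot hW p ℓ hℓp (by rw [hΔ]; exact hℓΔ) hcard
      (forall_zmod_of_forall_lt fun t ht h0 ↦ hnoroot t ht ?_)
    rw [← ZMod.intCast_zmod_eq_zero_iff_dvd]
    push_cast at h0 ⊢
    linear_combination h0
  exact bsdp_of_mult_of_chaCertificate W p hCha hGZK hmult hp2 hirr hK hH hP hnt hpD hpN hI hr hq hv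

/-! ### §2. Pairs `3240a1`, `5780b1`, `6480a1`, `21660j1`, `23120v1`, `25920a1`, `51840g1`, `52020u1` -/

/-- **`BSD(E,5)` for `3240a1`** (`N = 3240 = 2^3·3^4·5`; `ρ̄_{E,5}` image `5S4`, `nonsplit` multiplicative at `5`, additive at
`2`, `3`, `∏ c_q = 4`) from Cha 2005 + GZK and the Heegner-index certificate. Kernel: `Δ ≠ 0`, global
minimality (§2 of `ChaPairsMinimality`), `5 ∣ Δ ∧ 5 ∤ c₄`, `E[5]` irreducible (`ℓ = 7`, `#Ẽ(𝔽_7) = 8`,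
`a_7 = 0`). Numbers (binders): `r_an ≤ 1`, `#Ш_an` a `5`-adic unit, the Heegner datum with
`5 ∤ [E(K) : ℤ y_K]` — two-engine certificate of unit `b2b-bsdres-x11c` gen 3: `K = ℚ(√-71)`,
`m = √(4ρ) = 8`, `ord₅ m = 0` (engine 1 cypari2 jobs j077792/j077793; engine 2 stdlib).
[cite: Miller2011LMS, Thm. 5.2 and Def. 1.1] [cite: Cremona2006, Table 1 (Cremona label 3240a1)] -/
theorem bsdp_c3240a1 (hCha : thm52_padicValNat_shaOrder_le)
    (hGZK : rank_eq_analyticRank_of_analyticRank_le_one)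
    (W : WeierstrassCurve ℚ) (hW : W = ⟨0, 0, 0, -948, -11228⟩)
    {N : ℕ} [NeZero N] {K : Type} [Field K] [NumberField K] (hK : IsImaginaryQuadratic K)
    (hH : SatisfiesHeegnerHypothesis N K) {P : (W.baseChange K).toAffine.Point}
    (hP : IsHeegnerPoint N W K P) (hnt : ¬ IsOfFinAddOrder P)
    (hpD : ¬ (5 : ℤ) ∣ NumberField.discr K) (hpN : ¬ 5 ^ 2 ∣ N)
    (hI : ¬ 5 ∣ (AddSubgroup.zmultiples P).index)
    (hr : W.analyticRank ≤ 1) {q : ℚ} (hq : shaAn W = (q : ℂ)) (hv : padicValRat 5 q = 0) :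
    BSDp W 5 := by
  subst hW
  haveI := isElliptic_of_discOf_ne_zero 0 0 0 (-948) (-11228) (by decide +kernel)
  haveI := isGloballyMinimal_of_krausCriterion_bounded₂ 0 0 0 (-948) (-11228) (by decide +kernel) (by decide +kernel)
    (by decide +kernel)
  haveI : Fact (Nat.Prime 5) := ⟨by norm_num⟩
  haveI : Fact (Nat.Prime 7) := ⟨by norm_num⟩
  exact bsdp_of_ainvs_of_chaCertificate hCha hGZK 0 0 0 (-948) (-11228) (integralModelInt_eq_of_map_eq _ (map_mk_int _ _ _ _ _))
    5 7 8 (by decide) (by decide +kernel) (by decide +kernel) (by decide) (by decide +kernel) card_c3240a1_7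
    (by decide +kernel) hK hH hP hnt (mod_cast hpD) hpN hI hr hq hv

/-- **`BSD(E,5)` for `5780b1`** (`N = 5780 = 2^2·5·17^2`; `ρ̄_{E,5}` image `5S4`, `nonsplit` multiplicative at `5`, additive at
`2`, `17`, `∏ c_q = 3`) from Cha 2005 + GZK and the Heegner-index certificate. Kernel: `Δ ≠ 0`, global
minimality (§2 of `ChaPairsMinimality`), `5 ∣ Δ ∧ 5 ∤ c₄`, `E[5]` irreducible (`ℓ = 3`, `#Ẽ(𝔽_3) = 4`,
`a_3 = 0`). Numbers (binders): `r_an ≤ 1`, `#Ш_an` a `5`-adic unit, the Heegner datum with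
`5 ∤ [E(K) : ℤ y_K]` — two-engine certificate of unit `b2b-bsdres-x11c` gen 3: `K = ℚ(√-151)`,
`m = √(4ρ) = 6`, `ord₅ m = 0` (engine 1 cypari2 jobs j077792/j077793; engine 2 stdlib).
[cite: Miller2011LMS, Thm. 5.2 and Def. 1.1] [cite: Cremona2006, Table 1 (Cremona label 5780b1)] -/
theorem bsdp_c5780b1 (hCha : thm52_padicValNat_shaOrder_le)
    (hGZK : rank_eq_analyticRank_of_analyticRank_le_one)
    (W : WeierstrassCurve ℚ) (hW : W = ⟨0, 0, 0, -78608, -7683932⟩)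
    {N : ℕ} [NeZero N] {K : Type} [Field K] [NumberField K] (hK : IsImaginaryQuadratic K)
    (hH : SatisfiesHeegnerHypothesis N K) {P : (W.baseChange K).toAffine.Point}
    (hP : IsHeegnerPoint N W K P) (hnt : ¬ IsOfFinAddOrder P)
    (hpD : ¬ (5 : ℤ) ∣ NumberField.discr K) (hpN : ¬ 5 ^ 2 ∣ N)
    (hI : ¬ 5 ∣ (AddSubgroup.zmultiples P).index)
    (hr : W.analyticRank ≤ 1) {q : ℚ} (hq : shaAn W = (q : ℂ)) (hv : padicValRat 5 q = 0) :
    BSDp W 5 := by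
  subst hW
  haveI := isElliptic_of_discOf_ne_zero 0 0 0 (-78608) (-7683932) (by decide +kernel)
  haveI := isGloballyMinimal_of_krausCriterion_bounded₂ 0 0 0 (-78608) (-7683932) (by decide +kernel) (by decide +kernel)
    (by decide +kernel)
  haveI : Fact (Nat.Prime 5) := ⟨by norm_num⟩
  haveI : Fact (Nat.Prime 3) := ⟨by norm_num⟩
  exact bsdp_of_ainvs_of_chaCertificate hCha hGZK 0 0 0 (-78608) (-7683932) (integralModelInt_eq_of_map_eq _ (map_mk_int _ _ _ _ _))
    5 3 4 (by decide) (by decide +kernel) (by decide +kernel) (by decide) (by decide +kernel) card_c5780b1_3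
    (by decide +kernel) hK hH hP hnt (mod_cast hpD) hpN hI hr hq hv

/-- **`BSD(E,5)` for `6480a1`** (`N = 6480 = 2^4·3^4·5`; `ρ̄_{E,5}` image `5S4`, `nonsplit` multiplicative at `5`, additive at
`2`, `3`, `∏ c_q = 1`) from Cha 2005 + GZK and the Heegner-index certificate. Kernel: `Δ ≠ 0`, global
minimality (§2 of `ChaPairsMinimality`), `5 ∣ Δ ∧ 5 ∤ c₄`, `E[5]` irreducible (`ℓ = 7`, `#Ẽ(𝔽_7) = 8`,
`a_7 = 0`). Numbers (binders): `r_an ≤ 1`, `#Ш_an` a `5`-adic unit, the Heegner datum with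
`5 ∤ [E(K) : ℤ y_K]` — two-engine certificate of unit `b2b-bsdres-x11c` gen 3: `K = ℚ(√-71)`,
`m = √(4ρ) = 2`, `ord₅ m = 0` (engine 1 cypari2 jobs j077792/j077793; engine 2 stdlib).
[cite: Miller2011LMS, Thm. 5.2 and Def. 1.1] [cite: Cremona2006, Table 1 (Cremona label 6480a1)] -/
theorem bsdp_c6480a1 (hCha : thm52_padicValNat_shaOrder_le)
    (hGZK : rank_eq_analyticRank_of_analyticRank_le_one)
    (W : WeierstrassCurve ℚ) (hW : W = ⟨0, 0, 0, -948, 11228⟩)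
    {N : ℕ} [NeZero N] {K : Type} [Field K] [NumberField K] (hK : IsImaginaryQuadratic K)
    (hH : SatisfiesHeegnerHypothesis N K) {P : (W.baseChange K).toAffine.Point}
    (hP : IsHeegnerPoint N W K P) (hnt : ¬ IsOfFinAddOrder P)
    (hpD : ¬ (5 : ℤ) ∣ NumberField.discr K) (hpN : ¬ 5 ^ 2 ∣ N)
    (hI : ¬ 5 ∣ (AddSubgroup.zmultiples P).index)
    (hr : W.analyticRank ≤ 1) {q : ℚ} (hq : shaAn W = (q : ℂ)) (hv : padicValRat 5 q = 0) :
    BSDp W 5 := by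
  subst hW
  haveI := isElliptic_of_discOf_ne_zero 0 0 0 (-948) 11228 (by decide +kernel)
  haveI := isGloballyMinimal_of_krausCriterion_bounded₂ 0 0 0 (-948) 11228 (by decide +kernel) (by decide +kernel)
    (by decide +kernel)
  haveI : Fact (Nat.Prime 5) := ⟨by norm_num⟩
  haveI : Fact (Nat.Prime 7) := ⟨by norm_num⟩
  exact bsdp_of_ainvs_of_chaCertificate hCha hGZK 0 0 0 (-948) 11228 (integralModelInt_eq_of_map_eq _ (map_mk_int _ _ _ _ _))
    5 7 8 (by decide) (by decide +kernel) (by decide +kernel) (by decide) (by decide +kernel) card_c6480a1_7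
    (by decide +kernel) hK hH hP hnt (mod_cast hpD) hpN hI hr hq hv

/-- **`BSD(E,5)` for `21660j1`** (`N = 21660 = 2^2·3·5·19^2`; `ρ̄_{E,5}` image `5S4`, `nonsplit` multiplicative at `5`, additive at
`2`, `19`, `∏ c_q = 2`) from Cha 2005 + GZK and the Heegner-index certificate. Kernel: `Δ ≠ 0`, global
minimality (§2 of `ChaPairsMinimality`), `5 ∣ Δ ∧ 5 ∤ c₄`, `E[5]` irreducible (`ℓ = 7`, `#Ẽ(𝔽_7) = 13`,
`a_7 = -5`). Numbers (binders): `r_an ≤ 1`, `#Ш_an` a `5`-adic unit, the Heegner datum with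
`5 ∤ [E(K) : ℤ y_K]` — two-engine certificate of unit `b2b-bsdres-x11c` gen 3: `K = ℚ(√-71)`,
`m = √(4ρ) = 8`, `ord₅ m = 0` (engine 1 cypari2 jobs j077792/j077793; engine 2 stdlib).
[cite: Miller2011LMS, Thm. 5.2 and Def. 1.1] [cite: Cremona2006, Table 1 (Cremona label 21660j1)] -/
theorem bsdp_c21660j1 (hCha : thm52_padicValNat_shaOrder_le)
    (hGZK : rank_eq_analyticRank_of_analyticRank_le_one)
    (W : WeierstrassCurve ℚ) (hW : W = ⟨0, -1, 0, 4079, 145870⟩)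
    {N : ℕ} [NeZero N] {K : Type} [Field K] [NumberField K] (hK : IsImaginaryQuadratic K)
    (hH : SatisfiesHeegnerHypothesis N K) {P : (W.baseChange K).toAffine.Point}
    (hP : IsHeegnerPoint N W K P) (hnt : ¬ IsOfFinAddOrder P)
    (hpD : ¬ (5 : ℤ) ∣ NumberField.discr K) (hpN : ¬ 5 ^ 2 ∣ N)
    (hI : ¬ 5 ∣ (AddSubgroup.zmultiples P).index)
    (hr : W.analyticRank ≤ 1) {q : ℚ} (hq : shaAn W = (q : ℂ)) (hv : padicValRat 5 q = 0) :
    BSDp W 5 := by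
  subst hW
  haveI := isElliptic_of_discOf_ne_zero 0 (-1) 0 4079 145870 (by decide +kernel)
  haveI := isGloballyMinimal_of_krausCriterion_bounded₂ 0 (-1) 0 4079 145870 (by decide +kernel) (by decide +kernel)
    (by decide +kernel)
  haveI : Fact (Nat.Prime 5) := ⟨by norm_num⟩
  haveI : Fact (Nat.Prime 7) := ⟨by norm_num⟩
  exact bsdp_of_ainvs_of_chaCertificate hCha hGZK 0 (-1) 0 4079 145870 (integralModelInt_eq_of_map_eq _ (map_mk_int _ _ _ _ _))
    5 7 13 (by decide) (by decide +kernel) (by decide +kernel) (by decide) (by decide +kernel) card_c21660j1_7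
    (by decide +kernel) hK hH hP hnt (mod_cast hpD) hpN hI hr hq hv

/-- **`BSD(E,5)` for `23120v1`** (`N = 23120 = 2^4·5·17^2`; `ρ̄_{E,5}` image `5S4`, `nonsplit` multiplicative at `5`, additive at
`2`, `17`, `∏ c_q = 2`) from Cha 2005 + GZK and the Heegner-index certificate. Kernel: `Δ ≠ 0`, global
minimality (§2 of `ChaPairsMinimality`), `5 ∣ Δ ∧ 5 ∤ c₄`, `E[5]` irreducible (`ℓ = 3`, `#Ẽ(𝔽_3) = 4`,
`a_3 = 0`). Numbers (binders): `r_an ≤ 1`, `#Ш_an` a `5`-adic unit, the Heegner datum with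
`5 ∤ [E(K) : ℤ y_K]` — two-engine certificate of unit `b2b-bsdres-x11c` gen 3: `K = ℚ(√-111)`,
`m = √(4ρ) = 8`, `ord₅ m = 0` (engine 1 cypari2 jobs j077792/j077793; engine 2 stdlib).
[cite: Miller2011LMS, Thm. 5.2 and Def. 1.1] [cite: Cremona2006, Table 1 (Cremona label 23120v1)] -/
theorem bsdp_c23120v1 (hCha : thm52_padicValNat_shaOrder_le)
    (hGZK : rank_eq_analyticRank_of_analyticRank_le_one)
    (W : WeierstrassCurve ℚ) (hW : W = ⟨0, 0, 0, -78608, 7683932⟩)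
    {N : ℕ} [NeZero N] {K : Type} [Field K] [NumberField K] (hK : IsImaginaryQuadratic K)
    (hH : SatisfiesHeegnerHypothesis N K) {P : (W.baseChange K).toAffine.Point}
    (hP : IsHeegnerPoint N W K P) (hnt : ¬ IsOfFinAddOrder P)
    (hpD : ¬ (5 : ℤ) ∣ NumberField.discr K) (hpN : ¬ 5 ^ 2 ∣ N)
    (hI : ¬ 5 ∣ (AddSubgroup.zmultiples P).index)
    (hr : W.analyticRank ≤ 1) {q : ℚ} (hq : shaAn W = (q : ℂ)) (hv : padicValRat 5 q = 0) :
    BSDp W 5 := by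
  subst hW
  haveI := isElliptic_of_discOf_ne_zero 0 0 0 (-78608) 7683932 (by decide +kernel)
  haveI := isGloballyMinimal_of_krausCriterion_bounded₂ 0 0 0 (-78608) 7683932 (by decide +kernel) (by decide +kernel)
    (by decide +kernel)
  haveI : Fact (Nat.Prime 5) := ⟨by norm_num⟩
  haveI : Fact (Nat.Prime 3) := ⟨by norm_num⟩
  exact bsdp_of_ainvs_of_chaCertificate hCha hGZK 0 0 0 (-78608) 7683932 (integralModelInt_eq_of_map_eq _ (map_mk_int _ _ _ _ _))
    5 3 4 (by decide) (by decide +kernel) (by decide +kernel) (by decide) (by decide +kernel) card_c23120v1_3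
    (by decide +kernel) hK hH hP hnt (mod_cast hpD) hpN hI hr hq hv

/-- **`BSD(E,5)` for `25920a1`** (`N = 25920 = 2^6·3^4·5`; `ρ̄_{E,5}` image `5S4`, `nonsplit` multiplicative at `5`, additive at
`2`, `3`, `∏ c_q = 1`) from Cha 2005 + GZK and the Heegner-index certificate. Kernel: `Δ ≠ 0`, global
minimality (§2 of `ChaPairsMinimality`), `5 ∣ Δ ∧ 5 ∤ c₄`, `E[5]` irreducible (`ℓ = 7`, `#Ẽ(𝔽_7) = 8`,
`a_7 = 0`). Numbers (binders): `r_an ≤ 1`, `#Ш_an` a `5`-adic unit, the Heegner datum with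
`5 ∤ [E(K) : ℤ y_K]` — two-engine certificate of unit `b2b-bsdres-x11c` gen 3: `K = ℚ(√-191)`,
`m = √(4ρ) = 6`, `ord₅ m = 0` (engine 1 cypari2 jobs j077792/j077793; engine 2 stdlib).
[cite: Miller2011LMS, Thm. 5.2 and Def. 1.1] [cite: Cremona2006, Table 1 (Cremona label 25920a1)] -/
theorem bsdp_c25920a1 (hCha : thm52_padicValNat_shaOrder_le)
    (hGZK : rank_eq_analyticRank_of_analyticRank_le_one)
    (W : WeierstrassCurve ℚ) (hW : W = ⟨0, 0, 0, -34128, 2425248⟩)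
    {N : ℕ} [NeZero N] {K : Type} [Field K] [NumberField K] (hK : IsImaginaryQuadratic K)
    (hH : SatisfiesHeegnerHypothesis N K) {P : (W.baseChange K).toAffine.Point}
    (hP : IsHeegnerPoint N W K P) (hnt : ¬ IsOfFinAddOrder P)
    (hpD : ¬ (5 : ℤ) ∣ NumberField.discr K) (hpN : ¬ 5 ^ 2 ∣ N)
    (hI : ¬ 5 ∣ (AddSubgroup.zmultiples P).index)
    (hr : W.analyticRank ≤ 1) {q : ℚ} (hq : shaAn W = (q : ℂ)) (hv : padicValRat 5 q = 0) :
    BSDp W 5 := by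
  subst hW
  haveI := isElliptic_of_discOf_ne_zero 0 0 0 (-34128) 2425248 (by decide +kernel)
  haveI := isGloballyMinimal_of_krausCriterion_bounded₂ 0 0 0 (-34128) 2425248 (by decide +kernel) (by decide +kernel)
    (by decide +kernel)
  haveI : Fact (Nat.Prime 5) := ⟨by norm_num⟩
  haveI : Fact (Nat.Prime 7) := ⟨by norm_num⟩
  exact bsdp_of_ainvs_of_chaCertificate hCha hGZK 0 0 0 (-34128) 2425248 (integralModelInt_eq_of_map_eq _ (map_mk_int _ _ _ _ _))
    5 7 8 (by decide) (by decide +kernel) (by decide +kernel) (by decide) (by decide +kernel) card_c25920a1_7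
    (by decide +kernel) hK hH hP hnt (mod_cast hpD) hpN hI hr hq hv

/-- **`BSD(E,5)` for `51840g1`** (`N = 51840 = 2^7·3^4·5`; `ρ̄_{E,5}` image `5S4`, `nonsplit` multiplicative at `5`, additive at
`2`, `3`, `∏ c_q = 3`) from Cha 2005 + GZK and the Heegner-index certificate. Kernel: `Δ ≠ 0`, global
minimality (§2 of `ChaPairsMinimality`), `5 ∣ Δ ∧ 5 ∤ c₄`, `E[5]` irreducible (`ℓ = 11`, `#Ẽ(𝔽_11) = 16`,
`a_11 = -4`). Numbers (binders): `r_an ≤ 1`, `#Ш_an` a `5`-adic unit, the Heegner datum with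
`5 ∤ [E(K) : ℤ y_K]` — two-engine certificate of unit `b2b-bsdres-x11c` gen 3: `K = ℚ(√-71)`,
`m = √(4ρ) = 6`, `ord₅ m = 0` (engine 1 cypari2 jobs j077792/j077793; engine 2 stdlib).
[cite: Miller2011LMS, Thm. 5.2 and Def. 1.1] [cite: Cremona2006, Table 1 (Cremona label 51840g1)] -/
theorem bsdp_c51840g1 (hCha : thm52_padicValNat_shaOrder_le)
    (hGZK : rank_eq_analyticRank_of_analyticRank_le_one)
    (W : WeierstrassCurve ℚ) (hW : W = ⟨0, 0, 0, -153, -1098⟩)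
    {N : ℕ} [NeZero N] {K : Type} [Field K] [NumberField K] (hK : IsImaginaryQuadratic K)
    (hH : SatisfiesHeegnerHypothesis N K) {P : (W.baseChange K).toAffine.Point}
    (hP : IsHeegnerPoint N W K P) (hnt : ¬ IsOfFinAddOrder P)
    (hpD : ¬ (5 : ℤ) ∣ NumberField.discr K) (hpN : ¬ 5 ^ 2 ∣ N)
    (hI : ¬ 5 ∣ (AddSubgroup.zmultiples P).index)
    (hr : W.analyticRank ≤ 1) {q : ℚ} (hq : shaAn W = (q : ℂ)) (hv : padicValRat 5 q = 0) :
    BSDp W 5 := by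
  subst hW
  haveI := isElliptic_of_discOf_ne_zero 0 0 0 (-153) (-1098) (by decide +kernel)
  haveI := isGloballyMinimal_of_krausCriterion_bounded₂ 0 0 0 (-153) (-1098) (by decide +kernel) (by decide +kernel)
    (by decide +kernel)
  haveI : Fact (Nat.Prime 5) := ⟨by norm_num⟩
  haveI : Fact (Nat.Prime 11) := ⟨by norm_num⟩
  exact bsdp_of_ainvs_of_chaCertificate hCha hGZK 0 0 0 (-153) (-1098) (integralModelInt_eq_of_map_eq _ (map_mk_int _ _ _ _ _))
    5 11 16 (by decide) (by decide +kernel) (by decide +kernel) (by decide) (by decide +kernel) card_c51840g1_11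
    (by decide +kernel) hK hH hP hnt (mod_cast hpD) hpN hI hr hq hv

/-- **`BSD(E,5)` for `52020u1`** (`N = 52020 = 2^2·3^2·5·17^2`; `ρ̄_{E,5}` image `5S4`, `nonsplit` multiplicative at `5`, additive at
`2`, `3`, `17`, `∏ c_q = 2`) from Cha 2005 + GZK and the Heegner-index certificate. Kernel: `Δ ≠ 0`, global
minimality (§2 of `ChaPairsMinimality`), `5 ∣ Δ ∧ 5 ∤ c₄`, `E[5]` irreducible (`ℓ = 11`, `#Ẽ(𝔽_11) = 13`,
`a_11 = -1`). Numbers (binders): `r_an ≤ 1`, `#Ш_an` a `5`-adic unit, the Heegner datum with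
`5 ∤ [E(K) : ℤ y_K]` — two-engine certificate of unit `b2b-bsdres-x11c` gen 3: `K = ℚ(√-191)`,
`m = √(4ρ) = 12`, `ord₅ m = 0` (engine 1 cypari2 jobs j077792/j077793; engine 2 stdlib).
[cite: Miller2011LMS, Thm. 5.2 and Def. 1.1] [cite: Cremona2006, Table 1 (Cremona label 52020u1)] -/
theorem bsdp_c52020u1 (hCha : thm52_padicValNat_shaOrder_le)
    (hGZK : rank_eq_analyticRank_of_analyticRank_le_one)
    (W : WeierstrassCurve ℚ) (hW : W = ⟨0, 0, 0, -2448, 42228⟩)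
    {N : ℕ} [NeZero N] {K : Type} [Field K] [NumberField K] (hK : IsImaginaryQuadratic K)
    (hH : SatisfiesHeegnerHypothesis N K) {P : (W.baseChange K).toAffine.Point}
    (hP : IsHeegnerPoint N W K P) (hnt : ¬ IsOfFinAddOrder P)
    (hpD : ¬ (5 : ℤ) ∣ NumberField.discr K) (hpN : ¬ 5 ^ 2 ∣ N)
    (hI : ¬ 5 ∣ (AddSubgroup.zmultiples P).index)
    (hr : W.analyticRank ≤ 1) {q : ℚ} (hq : shaAn W = (q : ℂ)) (hv : padicValRat 5 q = 0) :
    BSDp W 5 := by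
  subst hW
  haveI := isElliptic_of_discOf_ne_zero 0 0 0 (-2448) 42228 (by decide +kernel)
  haveI := isGloballyMinimal_of_krausCriterion_bounded₂ 0 0 0 (-2448) 42228 (by decide +kernel) (by decide +kernel)
    (by decide +kernel)
  haveI : Fact (Nat.Prime 5) := ⟨by norm_num⟩
  haveI : Fact (Nat.Prime 11) := ⟨by norm_num⟩
  exact bsdp_of_ainvs_of_chaCertificate hCha hGZK 0 0 0 (-2448) 42228 (integralModelInt_eq_of_map_eq _ (map_mk_int _ _ _ _ _))
    5 11 13 (by decide) (by decide +kernel) (by decide +kernel) (by decide) (by decide +kernel) card_c52020u1_11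
    (by decide +kernel) hK hH hP hnt (mod_cast hpD) hpN hI hr hq hv

end Summit.BirchSwinnertonDyer.Rank1Residual.X11b

end
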